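import Literature.AlgebraicGeometry.HodgeTheory.RelativeHyperplaneClassHodgeRiemann
import Literature.AlgebraicGeometry.HodgeTheory.HodgeGenericQbarDescentProofs
import Literature.AlgebraicGeometry.HodgeTheory.SpreadingOutQbarFamilyProofs
import Literature.AlgebraicGeometry.HodgeTheory.IsoTransport
import Literature.AlgebraicGeometry.HodgeTheory.QbarGenericPointsDense
import Summits.HodgeConjecture.HodgeConjecture.Theses.PeriodDeficiency
import HarnessLib

/-!
# Route `LinearSystemTorelli` — crux `MiddleDivisorSupportFourfold` (stmt-HodgeConjecture-2409),
# line `IdeatorFiveSketch`, stub A from TYPE STABILITY ALONE (unconditional reduction)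

Helper file for the crux item stmt-HodgeConjecture-2409 (`--supports`; it closes nothing), line
`IdeatorFiveSketch` (idea `weakly-nonfactor-descent`), lead c10, stub A
`stub_finiteMonodromyAtGenericSpread` of the registered skeleton
`Cruxes/MiddleDivisorSupportFourfold/Lines/IdeatorFiveSketch.lean` (finite monodromy orbit of a
rational `(2,2)`-class at the `ℚ̄`-generic point of a `ℚ̄`-spread of the fourfold).

Up to lead c9 the tree knew stub A only from the two route items `PeriodDeficiency.ClassicalGeometricVHS`
(stmt-11597) and `PeriodDeficiency.QbarGenericIsHodgeGeneric` (stmt-11595) MODULO the named fact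
`bku_finite_monodromyOrbit_of_isHodgeGenericIn` (p119481). Since then the tree PROVED the Hodge–Riemann
input of that fact for the relative hyperplane class of a quasi-projective `ℚ̄`-family
(`hodgeRiemann_polarizationForm_qbarFamily`, file `RelativeHyperplaneClassHodgeRiemann`), the lattice
finiteness of monodromy translates of bounded denominator, fixed type and constant norm
(`finite_setOf_isContinuationAlong_of_norm_eq_baseChangeHom`, file `MonodromyOrbitLatticeFiniteness`),
the monodromy invariance of the polarization form (`polarizationForm_transportFun_self`, file
`PolarizationFormMonodromyInvariant`) and the identification of flat continuations along loops with
transports along homotopy classes (`setOf_isContinuationAlong_eq_range_transportFun`). Assembling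
them gives, UNCONDITIONALLY:

* `linearSystemTorelli_finite_setOf_isContinuationAlong_of_forall_isOfHodgeType` — in the
  complexification of a smooth projective family of quasi-projective `ℚ̄`-varieties over a smooth
  irreducible base, a rational class ALL of whose continuations along loops are of type `(p,p)` has
  FINITE monodromy orbit (Cattani–Deligne–Kaplan 1995 §1 / Baldi–Klingler–Ullmo 2024 §3.2: the orbit
  lies in a lattice, in the positive definite `(p,p)`-part of the flat rational polarization, with
  constant norm);
* `stub_finiteMonodromyAtGenericSpread_of_typeStabilityAtQbarGeneric` — hence stub A follows from
  the single statement T "in a smooth projective `ℚ̄`-family of fourfolds, at a point over the generic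
  point of the base, every loop-continuation of a rational `(2,2)`-class is of type `(2,2)`" (the
  Hodge locus of the class through the `ℚ̄`-generic point is everything) — the exact transcendence
  kernel of the line, with NO named fact left on the A-side (the spread is the PROVED
  `spreadingOut_smoothProjective_qbarFamily_holds`).

T is implied by stmt-11597 ∧ stmt-11595 together with the type-stability-at-Hodge-generic-points
input `hType` of `bku_finite_monodromyOrbit_of_isHodgeGenericIn_of_hType` (so this is a weakening
of the A-side antecedent of p119481), and by HC(4,2) itself; it is OPEN.
-/

-- every declaration of this problem lives in `Summit.HodgeConjecture.HodgeConjecture.…`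
set_option linter.dupNamespace false

noncomputable section

open CategoryTheory AlgebraicGeometry Topology
open Literature.AlgebraicGeometry Literature.AlgebraicGeometry.Motives
open Literature.AlgebraicGeometry.HodgeTheory
open Literature.AlgebraicTopology.SingularHomology

namespace Summit.HodgeConjecture.HodgeConjecture.Theorems

/-- **A type-stable rational class has finite monodromy orbit (unconditional).** For
`σ : ℚ̄ →+* ℂ`, a `ℚ̄`-morphism `f₀ : 𝒳₀ ⟶ S₀` of quasi-projective `ℚ̄`-schemes with `S₀` smooth
irreducible whose complexification is a smooth projective family of relative dimension `n`, a complex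
point `s` and a rational class `α ∈ H²ᵖ(𝒳_s(ℂ); ℂ)`: if every flat continuation of `α` along every
loop at `s` is of Hodge type `(p,p)`, then the set of these continuations (the monodromy orbit of `α`)
is finite.  Proof (Cattani–Deligne–Kaplan §1; Baldi–Klingler–Ullmo §3.2): the relative hyperplane
class gives a flat polarization form `Q` on `H²ᵖ(𝒳_s)`, rational on rational classes and positive
definite on rational `(p,p)`-classes (`hodgeRiemann_polarizationForm_qbarFamily`, PROVED); monodromy
preserves `Q`-norms (`polarizationForm_transportFun_self`), rationality and a common denominator, so
the orbit is a bounded subset of a lattice (`finite_setOf_isContinuationAlong_of_norm_eq_baseChangeHom`);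
continuations along loops are the transports along homotopy classes
(`setOf_isContinuationAlong_eq_range_transportFun`).
[cite: CattaniDeligneKaplan1995JAMS, §1] [cite: BaldiKlinglerUllmo2024, §3.2]
[cite: VoisinHodgeI2002, Thm. 6.32 and §7.1.2] -/
theorem linearSystemTorelli_finite_setOf_isContinuationAlong_of_forall_isOfHodgeType
    (σ : AlgebraicClosure ℚ →+* ℂ) ⦃𝒳₀ S₀ : SchemeOver (AlgebraicClosure ℚ)⦄ (f₀ : 𝒳₀ ⟶ S₀)
    (n p : ℕ) (hf : IsSmoothProjectiveFamily ((baseChangeHom σ).map f₀) n)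
    (h𝒳₀ : IsQuasiProjectiveOver 𝒳₀) (hS₀ : IsQuasiProjectiveOver S₀)
    (hirr : IrreducibleSpace S₀.left) (hsm : AlgebraicGeometry.Smooth S₀.hom)
    (s : ComplexPoints ((baseChangeHom σ).obj S₀))
    (α : complexBetti (fiberOver ((baseChangeHom σ).map f₀) s) (2 * p)) (hα : IsRationalClass α)
    (hT : ∀ (γ : Path s s) (β : complexBetti (fiberOver ((baseChangeHom σ).map f₀) s) (2 * p)),
      IsContinuationAlong γ α β →
        IsOfHodgeType n (fiberOver ((baseChangeHom σ).map f₀) s) (2 * p) p p β) :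
    {β : complexBetti (fiberOver ((baseChangeHom σ).map f₀) s) (2 * p) |
        ∃ γ : Path s s, IsContinuationAlong γ α β}.Finite := by
  haveI := hirr
  haveI := hsm
  have hXs : IsSmoothProjective n (fiberOver ((baseChangeHom σ).map f₀) s) :=
    hf.isSmoothProjective s
  -- a Hodge model of the fibre, read off the type of `α` itself (constant loop)
  obtain ⟨A, -⟩ := hT (Path.refl s) α (IsContinuationAlong.refl α)
  -- Hodge–Riemann for the relative hyperplane class at `s` (PROVED in the tree)
  obtain ⟨K, hL, τ, hQrat, hQpos⟩ :=
    hodgeRiemann_polarizationForm_qbarFamily σ f₀ n p hf h𝒳₀ hS₀ hirr hsm s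
  refine finite_setOf_isContinuationAlong_of_norm_eq_baseChangeHom (2 * p) σ f₀ hf hS₀ s
    (fun x ↦ IsOfHodgeType n (fiberOver ((baseChangeHom σ).map f₀) s) (2 * p) p p x)
    (IsOfHodgeType.zero A (2 * p) p p) (fun x y hx hy ↦ hx.add hXs hy)
    (fun c x hx ↦ hx.smul (c : ℂ)) _ hQrat hQpos α hα (fun γ ↦ ?_) (fun γ ↦ ?_)
  · -- a transport along a homotopy class of loops is a continuation along a loop: type `(p,p)` by `hT`
    have hmem : (transportFun ((baseChangeHom σ).map f₀) (2 * p)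
        (isCohomologicallyLocallyTrivialOn_univ_baseChangeHom σ f₀ hf hS₀) γ α :) ∈
        {β : complexBetti (fiberOver ((baseChangeHom σ).map f₀) s) (2 * p) |
          ∃ γ : Path s s, IsContinuationAlong γ α β} := by
      rw [setOf_isContinuationAlong_eq_range_transportFun ((baseChangeHom σ).map f₀) (2 * p)
        (isCohomologicallyLocallyTrivialOn_univ_baseChangeHom σ f₀ hf hS₀) s α]
      exact ⟨γ, rfl⟩
    obtain ⟨γ', hγ'⟩ := hmem
    exact hT γ' _ hγ'
  · exact polarizationForm_transportFun_self ((baseChangeHom σ).map f₀)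
      (isCohomologicallyLocallyTrivialOn_univ_baseChangeHom σ f₀ hf hS₀) K (s := ⟨s, Set.mem_univ s⟩)
      hXs hL τ γ α

/-- **Stub A ⟸ type stability at `ℚ̄`-generic points, UNCONDITIONALLY** (registered sub-goal of
stmt-HodgeConjecture-2409; the antecedent `hT` comes first, then VERBATIM the registered stub A
`stub_finiteMonodromyAtGenericSpread` of line `IdeatorFiveSketch`).  The antecedent T: for every
`σ : ℚ̄ →+* ℂ`, every `ℚ̄`-morphism `f₀ : 𝒳₀ ⟶ S₀` of quasi-projective `ℚ̄`-schemes with `S₀` smooth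
irreducible and smooth projective complexification of relative dimension `4`, every complex point `s`
over the generic point of `S₀`, and every rational `(2,2)`-class `α` on `𝒳_s`, every flat continuation
of `α` along a loop at `s` is again of type `(2,2)` ("the Hodge locus of `α` passes through the
`ℚ̄`-generic point, hence is everything"; OPEN — implied by HC(4,2), and by stmt-11597 ∧ stmt-11595
with Deligne–André type stability at Hodge-generic points).  Proof: spread `X` out over `ℚ̄`
(`spreadingOut_smoothProjective_qbarFamily_holds`, PROVED: `e : X ≅ 𝒳_s`, `s` over the generic
point), transport `c` to `α := (e⁻¹)^* c` (rational, of type `(2,2)`), and apply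
`linearSystemTorelli_finite_setOf_isContinuationAlong_of_forall_isOfHodgeType` with `hT`.
[cite: Voisin2007HodgeLoci, §3, proof of Prop. 1.7] [cite: BaldiKlinglerUllmo2024, §3.2]
[cite: CattaniDeligneKaplan1995JAMS, §1] -/
theorem stub_finiteMonodromyAtGenericSpread_of_typeStabilityAtQbarGeneric :
    (∀ (σ : AlgebraicClosure ℚ →+* ℂ) ⦃𝒳₀ S₀ : SchemeOver (AlgebraicClosure ℚ)⦄ (f₀ : 𝒳₀ ⟶ S₀),
      IsQuasiProjectiveOver 𝒳₀ → IsQuasiProjectiveOver S₀ → IrreducibleSpace S₀.left →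
      AlgebraicGeometry.Smooth S₀.hom → IsSmoothProjectiveFamily ((baseChangeHom σ).map f₀) 4 →
      ∀ (s : ComplexPoints ((baseChangeHom σ).obj S₀)),
        closure {(baseChangeHomFst σ S₀).base s.pt} = (Set.univ : Set S₀.left) →
        ∀ (α : complexBetti (fiberOver ((baseChangeHom σ).map f₀) s) 4),
          IsRationalClass α → IsOfHodgeType 4 (fiberOver ((baseChangeHom σ).map f₀) s) 4 2 2 α →
          ∀ (γ : Path s s) (β : complexBetti (fiberOver ((baseChangeHom σ).map f₀) s) 4),
            IsContinuationAlong γ α β →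
              IsOfHodgeType 4 (fiberOver ((baseChangeHom σ).map f₀) s) 4 2 2 β) →
    ∀ (σ : AlgebraicClosure ℚ →+* ℂ) ⦃X : SchemeOver ℂ⦄, IsSmoothProjective 4 X →
      ∀ (c : complexBetti X 4), IsRationalClass c → IsOfHodgeType 4 X 4 2 2 c →
        ∃ (𝒳₀ S₀ : SchemeOver (AlgebraicClosure ℚ)) (f₀ : 𝒳₀ ⟶ S₀)
          (s : ComplexPoints ((baseChangeHom σ).obj S₀))
          (e : X ≅ fiberOver ((baseChangeHom σ).map f₀) s),
          IsQuasiProjectiveOver 𝒳₀ ∧ IsQuasiProjectiveOver S₀ ∧ IrreducibleSpace S₀.left ∧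
          AlgebraicGeometry.Smooth S₀.hom ∧
          IsSmoothProjectiveFamily ((baseChangeHom σ).map f₀) 4 ∧
          closure {(baseChangeHomFst σ S₀).base s.pt} = (Set.univ : Set S₀.left) ∧
          {β : complexBetti (fiberOver ((baseChangeHom σ).map f₀) s) 4 |
              ∃ γ : Path s s, IsContinuationAlong γ (complexBetti.map e.inv 4 c) β}.Finite := by
  intro hT σ X hX c hc hh
  -- spread `X` out over `ℚ̄`: `e : X ≅ 𝒳_s`, `s` over the generic point of `S₀`
  obtain ⟨𝒳₀, S₀, f₀, s, h𝒳₀, hS₀, hirr, hsm, hf, hgen, ⟨e⟩⟩ :=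
    spreadingOut_smoothProjective_qbarFamily_holds σ hX
  refine ⟨𝒳₀, S₀, f₀, s, e, h𝒳₀, hS₀, hirr, hsm, hf, hgen, ?_⟩
  exact linearSystemTorelli_finite_setOf_isContinuationAlong_of_forall_isOfHodgeType σ f₀ 4 2 hf
    h𝒳₀ hS₀ hirr hsm s (complexBetti.map e.inv 4 c) (hc.map _)
    (hT σ f₀ h𝒳₀ hS₀ hirr hsm hf s hgen (complexBetti.map e.inv 4 c) (hc.map _)
      (hh.map_of_iso e.symm))

/-- **The weakening certificate: T ⟸ stmt-11597 ∧ stmt-11595 ∧ Deligne–André type stability at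
Hodge-generic points.**  The antecedent T of
`stub_finiteMonodromyAtGenericSpread_of_typeStabilityAtQbarGeneric` (type stability of the
loop-continuations of rational `(2,2)`-classes at points over the generic point of a smooth projective
`ℚ̄`-family of fourfolds) follows from the route items `PeriodDeficiency.ClassicalGeometricVHS`
(stmt-11597: a classical Betti–Hodge datum `B`, Deligne's tensor facts, geometric VHS data `D`) and
`PeriodDeficiency.QbarGenericIsHodgeGeneric` (stmt-11595: `s` is Hodge-generic in its `ℚ̄`-Zariski
closure) together with the single remaining classical input `hType` of the tree's
`bku_finite_monodromyOrbit_of_isHodgeGenericIn_of_hType` (at a point of maximal Mumford–Tate rank the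
monodromy translates of a rational `(p,p)` class are of type `(p,p)`; Deligne 1972 Prop. 7.5, André
1992 Thm. 1), VERBATIM.  So replacing stub A's antecedent "stmt-11597 ∧ stmt-11595 ∧
`bku_finite_monodromyOrbit_of_isHodgeGenericIn`" (p119481) by T loses nothing.  Proof: the
`ℚ̄`-Zariski closure of a point over the generic point is everything
(`IsDefinedOverQbar.eq_univ_of_closure_base_pt_eq_univ`), Hodge-genericity for `D` is maximality of
the Mumford–Tate rank on real carriers (`GeometricVHSData.mtRankAt_eq_mtRank_hodgeStructure`), and a
continuation along a loop is the transport along its homotopy class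
(`isContinuationAlong_iff_transportFun_eq`). [cite: BaldiKlinglerUllmo2024, §3.2]
[cite: Deligne1972WeilK3, Prop. 7.5] [cite: Voisin2007HodgeLoci, §3, proof of Prop. 1.7] -/
theorem linearSystemTorelli_typeStabilityAtQbarGeneric_of_qbarGenericIsHodgeGeneric_of_hType
    (hC : Summit.HodgeConjecture.HodgeConjecture.Theses.PeriodDeficiency.ClassicalGeometricVHS)
    (hG : Summit.HodgeConjecture.HodgeConjecture.Theses.PeriodDeficiency.QbarGenericIsHodgeGeneric)
    (hType : ∀ [HodgeTensorFacts.{0, 0}] (σ : AlgebraicClosure ℚ →+* ℂ)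
      ⦃𝒳₀ S₀ : SchemeOver (AlgebraicClosure ℚ)⦄ (f₀ : 𝒳₀ ⟶ S₀) (n p : ℕ)
      (hf : IsSmoothProjectiveFamily ((baseChangeHom σ).map f₀) n)
      (_ : IsQuasiProjectiveOver 𝒳₀) (hS₀ : IsQuasiProjectiveOver S₀) [IrreducibleSpace S₀.left]
      [AlgebraicGeometry.Smooth S₀.hom]
      (A : ∀ t : ComplexPoints ((baseChangeHom σ).obj S₀),
          HodgeModel n (fiberOver ((baseChangeHom σ).map f₀) t))
      (hA : ∀ t, (A t).IsHodgeSymmetric)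
      [∀ t, Module.Finite ℚ
        (singularCohomology ℚ ℚ (ComplexPoints (fiberOver ((baseChangeHom σ).map f₀) t)) (2 * p))]
      (s : ComplexPoints ((baseChangeHom σ).obj S₀)),
      (∀ t, ((A t).hodgeStructure (hf.isSmoothProjective t) (hA t) (2 * p)).mtRank ≤
          ((A s).hodgeStructure (hf.isSmoothProjective s) (hA s) (2 * p)).mtRank) →
      ∀ (α : complexBetti (fiberOver ((baseChangeHom σ).map f₀) s) (2 * p)),
        IsRationalClass α → IsOfHodgeType n (fiberOver ((baseChangeHom σ).map f₀) s) (2 * p) p p α →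
        ∀ γ : Path.Homotopic.Quotient
            (⟨s, Set.mem_univ s⟩ : (Set.univ : Set (ComplexPoints ((baseChangeHom σ).obj S₀))))
            ⟨s, Set.mem_univ s⟩,
          IsOfHodgeType n (fiberOver ((baseChangeHom σ).map f₀) s) (2 * p) p p
            (transportFun ((baseChangeHom σ).map f₀) (2 * p)
              (isCohomologicallyLocallyTrivialOn_univ_baseChangeHom σ f₀ hf hS₀) γ α :)) :
    ∀ (σ : AlgebraicClosure ℚ →+* ℂ) ⦃𝒳₀ S₀ : SchemeOver (AlgebraicClosure ℚ)⦄ (f₀ : 𝒳₀ ⟶ S₀),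
      IsQuasiProjectiveOver 𝒳₀ → IsQuasiProjectiveOver S₀ → IrreducibleSpace S₀.left →
      AlgebraicGeometry.Smooth S₀.hom → IsSmoothProjectiveFamily ((baseChangeHom σ).map f₀) 4 →
      ∀ (s : ComplexPoints ((baseChangeHom σ).obj S₀)),
        closure {(baseChangeHomFst σ S₀).base s.pt} = (Set.univ : Set S₀.left) →
        ∀ (α : complexBetti (fiberOver ((baseChangeHom σ).map f₀) s) 4),
          IsRationalClass α → IsOfHodgeType 4 (fiberOver ((baseChangeHom σ).map f₀) s) 4 2 2 α →
          ∀ (γ : Path s s) (β : complexBetti (fiberOver ((baseChangeHom σ).map f₀) s) 4),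
            IsContinuationAlong γ α β →
              IsOfHodgeType 4 (fiberOver ((baseChangeHom σ).map f₀) s) 4 2 2 β := by
  intro σ 𝒳₀ S₀ f₀ h𝒳₀ hS₀ hirr hsm hf s hgen α hα hh γ β hβ
  haveI := hirr
  haveI := hsm
  -- the classical Betti–Hodge datum and the geometric VHS datum of `R⁴ f_* ℚ`
  obtain ⟨B, hBc, hTF, hD⟩ := hC
  haveI : HodgeTensorFacts.{0, 0} := hTF
  obtain ⟨D, hfin⟩ := hD σ f₀ 4 (2 * 2) hf hirr hsm
  haveI : ∀ t, Module.Finite ℚ (D.V.fiber t) := hfin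
  -- `s` is Hodge-generic in its `ℚ̄`-Zariski closure, which is everything
  have hHG := hG B hBc σ f₀ 4 (2 * 2) D hirr hsm s
  have hW : (⋂₀ {Z | IsDefinedOverQbar σ S₀ Z ∧ s ∈ Z}) =
      (Set.univ : Set (ComplexPoints ((baseChangeHom σ).obj S₀))) := by
    rw [Set.sInter_eq_univ]
    rintro Z ⟨hZ, hsZ⟩
    haveI : LocallyOfFiniteType S₀.hom := locallyOfFiniteType_of_isQuasiProjectiveOver hS₀
    exact hZ.eq_univ_of_closure_base_pt_eq_univ hsZ hgen
  rw [hW] at hHG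
  -- Hodge-symmetric models of the fibres; Hodge-genericity read as maximal Mumford–Tate rank
  choose A hA using fun t : ComplexPoints ((baseChangeHom σ).obj S₀) ↦
    exists_isReal_hodgeModel_holds.exists_isHodgeSymmetric (hf.isSmoothProjective t)
  haveI : ∀ t : ComplexPoints ((baseChangeHom σ).obj S₀), Module.Finite ℚ
      (singularCohomology ℚ ℚ (ComplexPoints (fiberOver ((baseChangeHom σ).map f₀) t)) (2 * 2)) :=
    fun t ↦ finite_singularCohomology_rat_complexPoints (hf.isSmoothProjective t) (2 * 2)
  have hgen' : ∀ t, ((A t).hodgeStructure (hf.isSmoothProjective t) (hA t) (2 * 2)).mtRank ≤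
      ((A s).hodgeStructure (hf.isSmoothProjective s) (hA s) (2 * 2)).mtRank := by
    intro t
    have ht := hHG.2 t (Set.mem_univ t)
    rwa [D.mtRankAt_eq_mtRank_hodgeStructure hBc (A t) (hA t),
      D.mtRankAt_eq_mtRank_hodgeStructure hBc (A s) (hA s)] at ht
  -- the continuation `β` is the transport of `α` along the homotopy class of `γ`
  have hβ' := (isContinuationAlong_iff_transportFun_eq ((baseChangeHom σ).map f₀) (2 * 2)
    (isCohomologicallyLocallyTrivialOn_univ_baseChangeHom σ f₀ hf hS₀) γ α β).1 hβ
  subst hβ'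
  exact hType σ f₀ 4 2 hf h𝒳₀ hS₀ A hA s hgen' α hα hh _

end Summit.HodgeConjecture.HodgeConjecture.Theorems

end
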